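import Summits.CriticalPhenomena.PercolationContinuityZ3.Theorems.PercNearOneGluingNoHeavyQuantDIBCornerOneLight
import Summits.CriticalPhenomena.PercolationContinuityZ3.Theorems.PercNearOneGluingNoHeavyQuantIndepBlobDiscountLow
import Summits.CriticalPhenomena.PercolationContinuityZ3.Theorems.PercNearOneGluingNoHeavyQuantIndepBlobExtraBlobs
import HarnessLib

/-!
# QUANT lane R8, Conjecture DIB\* WITH EXACTLY ONE LIGHT BLOB — KERNEL AT EVERY FLOOR (capstone of the one-light case)

builds on p205010 (kernel theorem, internal audit signed; external expert review pending)

Support file (`--supports stmt-CriticalPhenomena-4575`), QUANT lane census seat prim-quant-census-1 (gen 14).  Assembles three kernel rows into one statement: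
lead g15's `IndepBlob.dibStar_of_le_half` (`…QuantIndepBlobDiscountLow`, floors `≤ 1/2`), lead g15's `IndepBlob.sizeRow_with_extra_blobs`
(`…QuantIndepBlobExtraBlobs`, floor `≥ 1/2`, heavy total `≥ 2j+1`) and census-1 g14's `IndepBlob.dibCorner_of_oneLight` (`…QuantDIBCornerOneLight`,
floor `≥ 1/2`, heavy total `≤ 2j`).

* `IndepBlob.dib_oneLight` — **blobs `k : κ` with sizes `a k ∈ ℕ` and gates `g k ∈ [0,1]`; floor `0 < x < 1`; ONE light blob `ℓ` (`g ℓ < x`, `a ℓ ≤ j`), all other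
  blobs heavy (`x ≤ g k`); credit `2j < Σ_{k ≠ ℓ} a k·g k + a ℓ·(g ℓ − x²)/(1 − x)` ⟹ `x ≤ P(Σ_{k open} a k ≥ j+1)`.**  This is census-2 g49's Conjecture DIB\*
  (`Quant.IndepBlob.DIBStar`) for every configuration with a single light blob, at every floor; several light blobs remain the open corner
  (`Quant.IndepBlob.DIBStarCorner`, README V192).
[cite: KozmaNitzan2024, Conjecture 3 (p. 15)] (the gluing rows served); [this work].  Theorems only, no sorries, standard axioms.
-/

namespace Summit.CriticalPhenomena.PercolationContinuityZ3.Theorems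

namespace Quant

namespace IndepBlob

open Finset

universe u

variable {κ : Type u} [Fintype κ] [DecidableEq κ]

/-- **DIB\* with exactly one light blob, every floor.**  See the module docstring. [this work] -/
theorem dib_oneLight (x : ℝ) (hx0 : 0 < x) (hx1 : x < 1) (a : κ → ℕ) (g : κ → ℝ) (j : ℕ)
    (hg : ∀ k, 0 ≤ g k ∧ g k ≤ 1) (ℓ : κ) (hℓ : g ℓ < x) (haℓ : a ℓ ≤ j) (hheavy : ∀ k, k ≠ ℓ → x ≤ g k)
    (hcredit : (2 * j : ℝ) < (∑ k ∈ (Finset.univ : Finset κ).erase ℓ, (a k : ℝ) * g k) + a ℓ * ((g ℓ - x ^ 2) / (1 - x))) :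
    x ≤ ∑ W : Finset κ, (∏ k, if k ∈ W then g k else 1 - g k) * (if j + 1 ≤ ∑ k ∈ W, a k then (1 : ℝ) else 0) := by
  have hg0 : ∀ k, 0 ≤ g k := fun k => (hg k).1
  have hg1 : ∀ k, g k ≤ 1 := fun k => (hg k).2
  -- the conclusion in filter form, and its complement
  have hform : ∑ W : Finset κ, (∏ k, if k ∈ W then g k else 1 - g k) * (if j + 1 ≤ ∑ k ∈ W, a k then (1 : ℝ) else 0) =
      ∑ W ∈ (Finset.univ : Finset (Finset κ)).filter (fun s => j + 1 ≤ ∑ k ∈ s, a k), (∏ k, if k ∈ W then g k else 1 - g k) := by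
    rw [Finset.sum_filter]
    exact Finset.sum_congr rfl fun W _ => by split_ifs <;> simp
  have hcompl : ∑ W ∈ (Finset.univ : Finset (Finset κ)).filter (fun s => j + 1 ≤ ∑ k ∈ s, a k), (∏ k, if k ∈ W then g k else 1 - g k) =
      1 - ∑ W ∈ (Finset.univ : Finset (Finset κ)).filter (fun W => ∑ k ∈ W, (a k : ℝ) ≤ j), (∏ k, if k ∈ W then g k else 1 - g k) := by
    have htot := Finset.sum_filter_add_sum_filter_not (Finset.univ : Finset (Finset κ)) (fun W => ∑ k ∈ W, (a k : ℝ) ≤ j)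
      (fun W => ∏ k, if k ∈ W then g k else 1 - g k)
    rw [sum_bernoulliWeight] at htot
    have e : (Finset.univ : Finset (Finset κ)).filter (fun s => j + 1 ≤ ∑ k ∈ s, a k) =
        (Finset.univ : Finset (Finset κ)).filter (fun W => ¬ (∑ k ∈ W, (a k : ℝ) ≤ j)) := by
      ext W
      simp only [Finset.mem_filter, Finset.mem_univ, true_and]
      rw [← Nat.cast_sum, Nat.cast_le, not_le, Nat.lt_iff_add_one_le]
    rw [e]; linarith
  by_cases hxhalf : x ≤ 1 / 2
  · -- floors ≤ 1/2: lead g15's `dibStar_of_le_half` with heavy set `univ.erase ℓ`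
    rw [hform, hcompl]
    have hH : ∀ i ∈ (Finset.univ : Finset κ).erase ℓ, x ≤ g i := fun i hi => hheavy i (Finset.ne_of_mem_erase hi)
    have hL : ∀ i, i ∉ (Finset.univ : Finset κ).erase ℓ → g i ≤ x := by
      intro i hi
      have : i = ℓ := by
        by_contra hne; exact hi (Finset.mem_erase.2 ⟨hne, Finset.mem_univ _⟩)
      rw [this]; exact hℓ.le
    have hcomplset : ((Finset.univ : Finset κ).erase ℓ)ᶜ = {ℓ} := by
      ext i; simp
    have hj : (2 * (j : ℝ)) < (∑ i ∈ (Finset.univ : Finset κ).erase ℓ, (a i : ℝ) * g i) +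
        ∑ i ∈ ((Finset.univ : Finset κ).erase ℓ)ᶜ, (a i : ℝ) * ((g i - x ^ 2) / (1 - x)) := by
      rw [hcomplset, Finset.sum_singleton]; exact hcredit
    have hlight : ∀ i, i ∉ (Finset.univ : Finset κ).erase ℓ → (a i : ℝ) ≤ j := by
      intro i hi
      have : i = ℓ := by
        by_contra hne; exact hi (Finset.mem_erase.2 ⟨hne, Finset.mem_univ _⟩)
      rw [this]; exact_mod_cast haℓ
    have h := dibStar_of_le_half g (fun k => (a k : ℝ)) x hx0.le hxhalf hg0 hg1 (fun k => Nat.cast_nonneg _)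
      ((Finset.univ : Finset κ).erase ℓ) hH hL (j : ℝ) hj hlight
    linarith
  push Not at hxhalf
  by_cases hcorner : (∑ k ∈ (Finset.univ : Finset κ).erase ℓ, (a k : ℝ)) ≤ 2 * j
  · exact dibCorner_of_oneLight x hxhalf.le hx1 a g j hg ℓ hℓ haℓ hheavy hcorner hcredit
  · -- heavy total ≥ 2j + 1: lead g15's size row with the light blob as an extra blob of arbitrary gate
    push Not at hcorner
    have hnat : 2 * j < ∑ k ∈ (Finset.univ : Finset κ).erase ℓ, a k := by
      have h' : ((2 * j : ℕ) : ℝ) < ((∑ k ∈ (Finset.univ : Finset κ).erase ℓ, a k : ℕ) : ℝ) := by push_cast; exact hcorner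
      exact_mod_cast h'
    have hsizeR : (2 * j + 1 : ℝ) ≤ ∑ k ∈ (Finset.univ : Finset κ).erase ℓ, (a k : ℝ) := by
      have h' : 2 * j + 1 ≤ ∑ k ∈ (Finset.univ : Finset κ).erase ℓ, a k := hnat
      have h'' : ((2 * j + 1 : ℕ) : ℝ) ≤ ((∑ k ∈ (Finset.univ : Finset κ).erase ℓ, a k : ℕ) : ℝ) := by exact_mod_cast h'
      push_cast at h''
      exact h''
    -- a heavy blob exists (the heavy total is positive); pick one of least gate
    have hne : ((Finset.univ : Finset κ).erase ℓ).Nonempty := by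
      by_contra h
      rw [Finset.not_nonempty_iff_eq_empty] at h
      rw [h, Finset.sum_empty] at hsizeR
      have : (0 : ℝ) ≤ j := Nat.cast_nonneg _
      linarith
    obtain ⟨y₀, hy₀mem, hy₀min⟩ := Finset.exists_min_image ((Finset.univ : Finset κ).erase ℓ) g hne
    have hy₀ℓ : y₀ ≠ ℓ := Finset.ne_of_mem_erase hy₀mem
    have hy₀E : y₀ ∉ ({ℓ} : Finset κ) := by rw [Finset.mem_singleton]; exact hy₀ℓ
    have hy₀ : ∀ k, k ∉ ({ℓ} : Finset κ) → g y₀ ≤ g k := by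
      intro k hk
      rw [Finset.mem_singleton] at hk
      exact hy₀min k (Finset.mem_erase.2 ⟨hk, Finset.mem_univ _⟩)
    have hhalfy : 1 / 2 ≤ g y₀ := le_trans hxhalf.le (hheavy y₀ hy₀ℓ)
    have hsize : 2 * j + 1 + ∑ k ∈ ({ℓ} : Finset κ), a k ≤ ∑ k, a k := by
      rw [Finset.sum_singleton, ← Finset.add_sum_erase _ _ (Finset.mem_univ ℓ)]
      have h' : 2 * j + 1 ≤ ∑ k ∈ (Finset.univ : Finset κ).erase ℓ, a k := hnat
      omega
    have h := sizeRow_with_extra_blobs g a hg0 hg1 ({ℓ} : Finset κ) y₀ hy₀E hy₀ hhalfy j hsize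
    rw [hform]
    exact le_trans (hheavy y₀ hy₀ℓ) h

end IndepBlob

end Quant

end Summit.CriticalPhenomena.PercolationContinuityZ3.Theorems
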